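import Literature.Computability.QuantumComplexity.GaussianRank

/-!
# `SymplecticPurity.GaussianDegreeBound` (stmt-QuantumAdvantage-9838) — III: purity is spectral mass

Helper file (prover, `--supports stmt-QuantumAdvantage-9838`) for the support item
`GaussianDegreeBound` of route SymplecticPurity: the identity
`‖Σ⁽⁴⁾‖ = 2^{-k} Σ_{S ∈ 𝒫^{<k} ⊗ I} |⟨φ|S|φ⟩|²` ("purity of the cut `{wires < k}` = Pauli spectral
mass on the cut", Kempe–Regev–Unger–de Wolf Observation 3 + Parseval) for the LITERAL 4-fold
agreement sum `Σ⁽⁴⁾` through which the route's items write `Tr ρ²_{wires<k}(φ)`, for every vector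
`φ` and every `k ≤ N`.  The proofs are those of §3 of the crux workfile
`Cruxes/CompositeFrameBound/Disproof.lean` (refuter-cdisprove-stmt-QuantumAdvantage-10730, gen 2),
restated without its auxiliary definitions (`lowWires`, `expect`, `cutPurity`) so that the lemma
applies to the Theses decl verbatim: the completeness kernel of the Pauli strings on the low wires
(`gdb_sum_stringsOn_low_apply_mul_star_apply`) evaluated on arbitrary labels IS `2^k ·` the agreement
indicator.
-/

set_option linter.dupNamespace false -- D-0017: single-problem summit ⇒ `QuantumAdvantage.QuantumAdvantage` by design

noncomputable section

namespace Summit.QuantumAdvantage.QuantumAdvantage.Theorems.SymplecticPurity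

open Matrix Finset
open Literature.Computability.QuantumComplexity Literature.Computability.Cryptography

-- adapted from Summits/QuantumAdvantage/QuantumAdvantage/Cruxes/CompositeFrameBound/Disproof.lean §3

/-- Membership in the low wire set `{i : i < k}`. -/
theorem gdb_mem_filter_lt {N k : ℕ} {i : Fin N} :
    i ∈ (Finset.univ.filter fun i : Fin N => i.val < k) ↔ i.val < k := by
  simp

/-- The low wire set `{i : i < k}` has `k` elements when `k ≤ N`. -/
theorem gdb_card_filter_lt {N k : ℕ} (hk : k ≤ N) :
    (Finset.univ.filter fun i : Fin N => i.val < k).card = k := by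
  have : (Finset.univ.filter fun i : Fin N => i.val < k) = Finset.univ.map (Fin.castLEEmb hk) := by
    ext i
    simp only [Finset.mem_filter, Finset.mem_univ, true_and, Finset.mem_map]
    constructor
    · intro hi
      exact ⟨⟨i, hi⟩, Fin.ext rfl⟩
    · rintro ⟨j, rfl⟩
      exact j.2
  rw [this, Finset.card_map, Finset.card_univ, Fintype.card_fin]

/-- A string on the low wires `{i : i < k}` is the identity on every wire `i` with `k ≤ i`. -/
theorem gdb_eq_I_of_mem_stringsOn_low {N k : ℕ} {S : Fin N → Pauli}
    (hS : S ∈ stringsOn (Finset.univ.filter fun i : Fin N => i.val < k)) (i : Fin N)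
    (hi : k ≤ i.val) : S i = Pauli.I :=
  mem_stringsOn.1 hS i fun h => absurd (gdb_mem_filter_lt.1 h) (not_lt.2 hi)

/-- **Entrywise completeness of the strings on the low wires, for ARBITRARY labels**:
`Σ_{S ∈ 𝒫^{<k} ⊗ I} S_{x₂x₁} conj(S_{x₃x₄}) = 2^k · [the four agreement conditions]`. -/
theorem gdb_sum_stringsOn_low_apply_mul_star_apply {N k : ℕ} (hk : k ≤ N)
    (x₁ x₂ x₃ x₄ : QReg N) :
    ∑ S ∈ stringsOn (Finset.univ.filter fun i : Fin N => i.val < k),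
        pauliString S x₂ x₁ * star (pauliString S x₃ x₄) =
      if (∀ i, k ≤ i.val → x₁ i = x₂ i) ∧ (∀ i, i.val < k → x₂ i = x₃ i) ∧
          (∀ i, k ≤ i.val → x₃ i = x₄ i) ∧ (∀ i, i.val < k → x₄ i = x₁ i)
      then (2 : ℂ) ^ k else 0 := by
  have hstar : ∀ S : Fin N → Pauli, star (pauliString S x₃ x₄) = pauliString S x₄ x₃ :=
    fun S => by
      have := congrFun (congrFun (conjTranspose_pauliString S) x₄) x₃
      rwa [Matrix.conjTranspose_apply] at this
  simp only [hstar]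
  simp only [pauliString_eq, tensorAll_apply, ← Finset.prod_mul_distrib, stringsOn]
  rw [← Finset.prod_univ_sum (fun i => if i ∈ (Finset.univ.filter fun i : Fin N => i.val < k)
      then Finset.univ else {Pauli.I})
    (fun i Q => Pauli.mat Q (x₂ i) (x₁ i) * Pauli.mat Q (x₄ i) (x₃ i))]
  have key : ∀ i : Fin N, (∑ Q ∈ (if i ∈ (Finset.univ.filter fun i : Fin N => i.val < k)
      then Finset.univ else {Pauli.I}),
      Pauli.mat Q (x₂ i) (x₁ i) * Pauli.mat Q (x₄ i) (x₃ i)) =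
      if (k ≤ i.val → x₂ i = x₁ i ∧ x₄ i = x₃ i) ∧ (i.val < k → x₂ i = x₃ i ∧ x₁ i = x₄ i)
      then (if i.val < k then 2 else 1) else 0 := by
    intro i
    by_cases hi : i.val < k
    · have hi' : ¬ k ≤ i.val := not_le.mpr hi
      rw [if_pos (gdb_mem_filter_lt.mpr hi), Pauli.sum_mat_mul_mat]
      simp only [hi', false_implies, true_and, hi, true_implies, if_true]
    · have hi' : k ≤ i.val := not_lt.mp hi
      rw [if_neg (fun h => hi (gdb_mem_filter_lt.mp h)), Finset.sum_singleton]
      simp only [Pauli.mat_I_apply, hi', true_implies, hi, false_implies, and_true, if_false]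
      by_cases h1 : x₂ i = x₁ i <;> by_cases h2 : x₄ i = x₃ i <;> simp [h1, h2]
  simp only [key, Fintype.prod_ite_zero]
  have hprod : (∏ i : Fin N, (if i.val < k then (2 : ℂ) else 1)) = 2 ^ k := by
    rw [Finset.prod_ite, Finset.prod_const_one, mul_one, Finset.prod_const]
    congr 1
    exact gdb_card_filter_lt hk
  rw [hprod]
  by_cases h : (∀ i, k ≤ i.val → x₁ i = x₂ i) ∧ (∀ i, i.val < k → x₂ i = x₃ i) ∧
      (∀ i, k ≤ i.val → x₃ i = x₄ i) ∧ (∀ i, i.val < k → x₄ i = x₁ i)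
  · rw [if_pos h, if_pos]
    intro i
    exact ⟨fun hi => ⟨(h.1 i hi).symm, (h.2.2.1 i hi).symm⟩,
      fun hi => ⟨h.2.1 i hi, (h.2.2.2 i hi).symm⟩⟩
  · rw [if_neg h, if_neg]
    intro h'
    exact h ⟨fun i hi => ((h' i).1 hi).1.symm, fun i hi => ((h' i).2 hi).1,
      fun i hi => ((h' i).1 hi).2.symm, fun i hi => ((h' i).2 hi).2.symm⟩

/-- Expansion of a Pauli expectation `⟨φ|S|φ⟩` into matrix entries. -/
theorem gdb_star_dotProduct_pauliString_mulVec {N : ℕ} (φ : QReg N → ℂ) (S : Fin N → Pauli) :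
    star φ ⬝ᵥ (pauliString S *ᵥ φ) = ∑ a, ∑ b, star (φ a) * (pauliString S a b * φ b) := by
  simp only [dotProduct, Matrix.mulVec, Pi.star_apply, Finset.mul_sum]

/-- **Purity = spectral mass on the cut** (4-fold-sum form): `2^k ·` (the 4-fold agreement sum of
`φ` at the cut `k`) `= Σ_{S ∈ 𝒫^{<k} ⊗ I} ⟨φ|S|φ⟩ · conj ⟨φ|S|φ⟩`, for every vector `φ` and `k ≤ N`. -/
theorem gdb_two_pow_mul_cutSum {N : ℕ} (φ : QReg N → ℂ) {k : ℕ} (hk : k ≤ N) :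
    (2 : ℂ) ^ k * ∑ x₁ : QReg N, ∑ x₂ : QReg N, ∑ x₃ : QReg N, ∑ x₄ : QReg N,
      (if (∀ i, k ≤ i.val → x₁ i = x₂ i) ∧ (∀ i, i.val < k → x₂ i = x₃ i) ∧
          (∀ i, k ≤ i.val → x₃ i = x₄ i) ∧ (∀ i, i.val < k → x₄ i = x₁ i)
        then φ x₁ * star (φ x₂) * φ x₃ * star (φ x₄) else 0) =
      ∑ S ∈ stringsOn (Finset.univ.filter fun i : Fin N => i.val < k),
        (star φ ⬝ᵥ (pauliString S *ᵥ φ)) * star (star φ ⬝ᵥ (pauliString S *ᵥ φ)) := by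
  have lhs : (2 : ℂ) ^ k * ∑ x₁ : QReg N, ∑ x₂ : QReg N, ∑ x₃ : QReg N, ∑ x₄ : QReg N,
      (if (∀ i, k ≤ i.val → x₁ i = x₂ i) ∧ (∀ i, i.val < k → x₂ i = x₃ i) ∧
          (∀ i, k ≤ i.val → x₃ i = x₄ i) ∧ (∀ i, i.val < k → x₄ i = x₁ i)
        then φ x₁ * star (φ x₂) * φ x₃ * star (φ x₄) else 0) = ∑ x₁, ∑ x₂, ∑ x₃, ∑ x₄,
      star (φ x₂) * φ x₁ * (φ x₃ * star (φ x₄)) *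
        (if (∀ i, k ≤ i.val → x₁ i = x₂ i) ∧ (∀ i, i.val < k → x₂ i = x₃ i) ∧
            (∀ i, k ≤ i.val → x₃ i = x₄ i) ∧ (∀ i, i.val < k → x₄ i = x₁ i)
          then (2 : ℂ) ^ k else 0) := by
    simp only [Finset.mul_sum]
    refine Finset.sum_congr rfl fun x₁ _ => Finset.sum_congr rfl fun x₂ _ =>
      Finset.sum_congr rfl fun x₃ _ => Finset.sum_congr rfl fun x₄ _ => ?_
    split_ifs <;> ring
  have rhs : ∀ S : Fin N → Pauli,
      (star φ ⬝ᵥ (pauliString S *ᵥ φ)) * star (star φ ⬝ᵥ (pauliString S *ᵥ φ)) =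
      ∑ x₂, ∑ x₁, ∑ x₃, ∑ x₄, star (φ x₂) * φ x₁ * (φ x₃ * star (φ x₄)) *
        (pauliString S x₂ x₁ * star (pauliString S x₃ x₄)) := by
    intro S
    rw [gdb_star_dotProduct_pauliString_mulVec]
    simp only [star_sum, star_mul', star_star, Finset.sum_mul_sum]
    refine Finset.sum_congr rfl fun x₂ _ => ?_
    rw [Finset.sum_comm]
    refine Finset.sum_congr rfl fun x₁ _ => Finset.sum_congr rfl fun x₃ _ =>
      Finset.sum_congr rfl fun x₄ _ => ?_
    ring
  rw [lhs, Finset.sum_congr rfl fun S _ => rhs S]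
  conv_lhs => rw [Finset.sum_comm]
  conv_rhs => rw [Finset.sum_comm]
  refine Finset.sum_congr rfl fun x₂ _ => ?_
  conv_rhs => rw [Finset.sum_comm]
  refine Finset.sum_congr rfl fun x₁ _ => ?_
  conv_rhs => rw [Finset.sum_comm]
  refine Finset.sum_congr rfl fun x₃ _ => ?_
  conv_rhs => rw [Finset.sum_comm]
  refine Finset.sum_congr rfl fun x₄ _ => ?_
  rw [← Finset.mul_sum, gdb_sum_stringsOn_low_apply_mul_star_apply hk]

/-- **Purity = spectral mass on the cut** (norm form): the norm of the 4-fold agreement sum of `φ`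
at the cut `k ≤ N` equals `2^{-k} Σ_{S ∈ 𝒫^{<k} ⊗ I} |⟨φ|S|φ⟩|²`. -/
theorem gdb_norm_cutSum_eq {N : ℕ} (φ : QReg N → ℂ) {k : ℕ} (hk : k ≤ N) :
    ‖∑ x₁ : QReg N, ∑ x₂ : QReg N, ∑ x₃ : QReg N, ∑ x₄ : QReg N,
      (if (∀ i, k ≤ i.val → x₁ i = x₂ i) ∧ (∀ i, i.val < k → x₂ i = x₃ i) ∧
          (∀ i, k ≤ i.val → x₃ i = x₄ i) ∧ (∀ i, i.val < k → x₄ i = x₁ i)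
        then φ x₁ * star (φ x₂) * φ x₃ * star (φ x₄) else 0)‖ =
      ((2 : ℝ) ^ k)⁻¹ * ∑ S ∈ stringsOn (Finset.univ.filter fun i : Fin N => i.val < k),
        ‖star φ ⬝ᵥ (pauliString S *ᵥ φ)‖ ^ 2 := by
  have h := gdb_two_pow_mul_cutSum φ hk
  set P := ∑ x₁ : QReg N, ∑ x₂ : QReg N, ∑ x₃ : QReg N, ∑ x₄ : QReg N,
      (if (∀ i, k ≤ i.val → x₁ i = x₂ i) ∧ (∀ i, i.val < k → x₂ i = x₃ i) ∧
          (∀ i, k ≤ i.val → x₃ i = x₄ i) ∧ (∀ i, i.val < k → x₄ i = x₁ i)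
        then φ x₁ * star (φ x₂) * φ x₃ * star (φ x₄) else 0) with hP
  have h2 : P = ((2 : ℂ) ^ k)⁻¹ * ∑ S ∈ stringsOn (Finset.univ.filter fun i : Fin N => i.val < k),
      (star φ ⬝ᵥ (pauliString S *ᵥ φ)) * star (star φ ⬝ᵥ (pauliString S *ᵥ φ)) := by
    rw [← h, ← mul_assoc, inv_mul_cancel₀ (pow_ne_zero _ two_ne_zero), one_mul]
  have h3 : ∀ S : Fin N → Pauli,
      (star φ ⬝ᵥ (pauliString S *ᵥ φ)) * star (star φ ⬝ᵥ (pauliString S *ᵥ φ)) =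
        ((‖star φ ⬝ᵥ (pauliString S *ᵥ φ)‖ ^ 2 : ℝ) : ℂ) := by
    intro S
    rw [Complex.star_def, Complex.mul_conj, Complex.normSq_eq_norm_sq, Complex.ofReal_pow]
  rw [h2]
  simp only [h3]
  rw [← Complex.ofReal_sum]
  rw [norm_mul, norm_inv, norm_pow, Complex.norm_ofNat, Complex.norm_real, Real.norm_eq_abs,
    abs_of_nonneg (Finset.sum_nonneg fun S _ => sq_nonneg _)]

end Summit.QuantumAdvantage.QuantumAdvantage.Theorems.SymplecticPurity

end
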